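import Mathlib
import HarnessLib
import Summits.Ventures.LatticeQCDFlow.Scaling.TopologicalCollar
import Summits.Ventures.LatticeQCDFlow.Exactness.U1MultiStepLeapfrogHMCErgodic

/-!
# The `U(1)` Wilson force field is bounded by `2(d−1)` and `8(d−1)`-Lipschitz: the short-trajectory hypothesis of multi-step leapfrog HMC, discharged for the Wilson action

HONEST FRAMING: exact (Metropolis-corrected) sampling algorithms for lattice gauge theory;
figures of merit are autocorrelation/cost numbers at stated couplings and volumes; no
continuum-physics claim.

Venture `LatticeQCDFlow` (cell pub-lqcd), topic `Exactness`, FANOUT row 14 (`eng-flowhmc`; equally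
row 9's `latflow.core` `U(1)` HMC `u1_2d.U1Field2D.hmc_trajectory(β, τ, nstep)`).  NEW WORK of the
cell over ROW 9's `U1MultiStepLeapfrogHMCErgodic.lean` (landed this morning:
`wilson_u1LeapfrogHMCN_uniformlyErgodic` — `n`-step leapfrog HMC converges to the Wilson measure
from every start for ANY `K`-Lipschitz bounded increment with `4Kεn² ≤ 3`, "the Wilson force's `K` is
`O(βεd)` and is not computed here"), row 29's `Scaling/TopologicalCollar.lean`
(`dist_plaquetteHolonomy_le`: each plaquette is `4`-Lipschitz for the chordal sup metric) and
GEN-11's `U1ExactForceWilson.lean` (named only: the exact autodiff gradient of `β·S_W` along the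
drift IS `−βcκ·Z`, so the engine's momentum increment is a real multiple `a·Z` of the field below);
nothing is cited as a fact; no number.  THIS FILE COMPUTES THAT `K`:

  `Z_e(V) = Σ_(ν ≠ μ) [Im U_(x−ν̂;μν)(V) − Im U_(x;μν)(V)]`,  `e = (x, μ)`
  (VERBATIM as in `exists_layers_u1WilsonFlowLO` / `u1ExactForce_wilson`),

* §1 `abs_u1FlowField_le` — `|Z_e(V)| ≤ 2(d−1)`; `abs_u1FlowField_sub_le` —
  `|Z_e(V) − Z_e(V')| ≤ 8(d−1)·dist(V, V')` (`|Im z − Im w| ≤ |z − w|`, each of the `2(d−1)`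
  plaquettes through the link is `4`-Lipschitz); for the increment `a·Z`: `norm_smul_u1FlowField_apply_le`
  (`|a Z_e(V)| ≤ 2(d−1)|a|`), **`lipschitzWith_smul_u1FlowField`** (`8(d−1)|a|`-Lipschitz, sup
  metrics), `measurable_smul_u1FlowField`;
* §2 **`wilson_u1LeapfrogHMCN_flowField_uniformlyErgodic`**,
  **`wilsonMeasure_unique_invariant_u1LeapfrogHMCN_flowField`** — on every torus `(ℤ/L)^d`, for
  every continuous representation `ρ` of `U(1)` and every `β`, every real `a`, `ε > 0`, `κ > 0`,
  `n ≥ 1` with the EXPLICIT short-trajectory condition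

    `32 (d−1) · |a| · ε · n² ≤ 3`,

  row 9's `n`-step leapfrog HMC kernel with increment `a·Z` and Metropolis test on `β·S_W + T_κ`
  converges to the Wilson measure `wilsonMeasure ρ β` geometrically from EVERY start, and that
  measure is its unique invariant probability law — no hypothesis left abstract.

NOT CLAIMED: longer trajectories; the value of `a` the engine uses (`−½·dt·(−βcκ)` by GEN-11's
identification — any real `a` is covered); `SU(2)`; OMF words; any usable rate; floating point; any
number.
-/

noncomputable section

namespace Summit.Ventures.LatticeQCDFlow.Exactness

open MeasureTheory ProbabilityTheory ProbabilityTheory.Kernel Set Metric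
open Literature.MathematicalPhysics.QuantumFieldTheory Literature.MathematicalPhysics.QuantumLattice
open Summit.Ventures.LatticeQCDFlow.Theory2.Lattice (dist_plaquetteHolonomy_le)
open scoped ENNReal NNReal

variable {d L : ℕ}

/-! ## §1 The leading-order Wilson-flow field on `U(1)`: bounded and Lipschitz -/

section Field

/-- `|Im z| ≤ 1` on the unit circle. -/
theorem abs_im_coe_circle_le (z : Circle) : |((z : Circle) : ℂ).im| ≤ 1 :=
  (Complex.abs_im_le_norm _).trans_eq (Circle.norm_coe z)

/-- `|Im z − Im w| ≤ dist(z, w)` on the unit circle (chordal metric). -/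
theorem abs_im_sub_im_le_dist (z w : Circle) :
    |((z : Circle) : ℂ).im - ((w : Circle) : ℂ).im| ≤ dist z w := by
  rw [← Complex.sub_im]
  refine (Complex.abs_im_le_norm _).trans_eq ?_
  change _ = dist (z : ℂ) (w : ℂ)
  rw [dist_eq_norm]

/-- **`|Z_e(V)| ≤ 2(d−1)`**: every plaquette holonomy is a unit complex number. -/
theorem abs_u1FlowField_le (V : GaugeConfig d L Circle) (e : Edge d L) :
    |∑ ν ∈ Finset.univ.erase e.2,
        (((plaquetteHolonomy V (e.1 - Pi.single ν 1) e.2 ν : Circle) : ℂ).im -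
          ((plaquetteHolonomy V e.1 e.2 ν : Circle) : ℂ).im)| ≤ 2 * ((d - 1 : ℕ) : ℝ) := by
  have hcard : (Finset.univ.erase e.2).card = d - 1 := by
    rw [Finset.card_erase_of_mem (Finset.mem_univ _), Finset.card_univ, Fintype.card_fin]
  calc |∑ ν ∈ Finset.univ.erase e.2,
        (((plaquetteHolonomy V (e.1 - Pi.single ν 1) e.2 ν : Circle) : ℂ).im -
          ((plaquetteHolonomy V e.1 e.2 ν : Circle) : ℂ).im)|
      ≤ ∑ ν ∈ Finset.univ.erase e.2,
        |(((plaquetteHolonomy V (e.1 - Pi.single ν 1) e.2 ν : Circle) : ℂ).im -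
          ((plaquetteHolonomy V e.1 e.2 ν : Circle) : ℂ).im)| := Finset.abs_sum_le_sum_abs _ _
    _ ≤ ∑ _ν ∈ Finset.univ.erase e.2, (2 : ℝ) := Finset.sum_le_sum fun ν _ => by
        refine (abs_sub _ _).trans ?_
        linarith [abs_im_coe_circle_le (plaquetteHolonomy V (e.1 - Pi.single ν 1) e.2 ν),
          abs_im_coe_circle_le (plaquetteHolonomy V e.1 e.2 ν)]
    _ = 2 * ((d - 1 : ℕ) : ℝ) := by rw [Finset.sum_const, nsmul_eq_mul, hcard, mul_comm]

variable [NeZero L]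

/-- **`|Z_e(V) − Z_e(V')| ≤ 8(d−1) · dist(V, V')`** (sup chordal metric on configurations): each of the
`2(d−1)` plaquettes through the link is `4`-Lipschitz. -/
theorem abs_u1FlowField_sub_le (V V' : GaugeConfig d L Circle) (e : Edge d L) :
    |(∑ ν ∈ Finset.univ.erase e.2,
        (((plaquetteHolonomy V (e.1 - Pi.single ν 1) e.2 ν : Circle) : ℂ).im -
          ((plaquetteHolonomy V e.1 e.2 ν : Circle) : ℂ).im)) -
      ∑ ν ∈ Finset.univ.erase e.2,
        (((plaquetteHolonomy V' (e.1 - Pi.single ν 1) e.2 ν : Circle) : ℂ).im -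
          ((plaquetteHolonomy V' e.1 e.2 ν : Circle) : ℂ).im)| ≤
      8 * ((d - 1 : ℕ) : ℝ) * dist V V' := by
  have hcard : (Finset.univ.erase e.2).card = d - 1 := by
    rw [Finset.card_erase_of_mem (Finset.mem_univ _), Finset.card_univ, Fintype.card_fin]
  rw [← Finset.sum_sub_distrib]
  calc |∑ ν ∈ Finset.univ.erase e.2,
        ((((plaquetteHolonomy V (e.1 - Pi.single ν 1) e.2 ν : Circle) : ℂ).im -
          ((plaquetteHolonomy V e.1 e.2 ν : Circle) : ℂ).im) -
         (((plaquetteHolonomy V' (e.1 - Pi.single ν 1) e.2 ν : Circle) : ℂ).im -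
          ((plaquetteHolonomy V' e.1 e.2 ν : Circle) : ℂ).im))|
      ≤ ∑ ν ∈ Finset.univ.erase e.2,
        |(((plaquetteHolonomy V (e.1 - Pi.single ν 1) e.2 ν : Circle) : ℂ).im -
          ((plaquetteHolonomy V e.1 e.2 ν : Circle) : ℂ).im) -
         (((plaquetteHolonomy V' (e.1 - Pi.single ν 1) e.2 ν : Circle) : ℂ).im -
          ((plaquetteHolonomy V' e.1 e.2 ν : Circle) : ℂ).im)| := Finset.abs_sum_le_sum_abs _ _
    _ ≤ ∑ _ν ∈ Finset.univ.erase e.2, 8 * dist V V' := Finset.sum_le_sum fun ν _ => by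
        have h1 := abs_im_sub_im_le_dist (plaquetteHolonomy V (e.1 - Pi.single ν 1) e.2 ν)
          (plaquetteHolonomy V' (e.1 - Pi.single ν 1) e.2 ν)
        have h2 := abs_im_sub_im_le_dist (plaquetteHolonomy V e.1 e.2 ν) (plaquetteHolonomy V' e.1 e.2 ν)
        have h3 := dist_plaquetteHolonomy_le V V' (e.1 - Pi.single ν 1) e.2 ν
        have h4 := dist_plaquetteHolonomy_le V V' e.1 e.2 ν
        have hre : (((plaquetteHolonomy V (e.1 - Pi.single ν 1) e.2 ν : Circle) : ℂ).im -
            ((plaquetteHolonomy V e.1 e.2 ν : Circle) : ℂ).im) -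
            (((plaquetteHolonomy V' (e.1 - Pi.single ν 1) e.2 ν : Circle) : ℂ).im -
              ((plaquetteHolonomy V' e.1 e.2 ν : Circle) : ℂ).im) =
            (((plaquetteHolonomy V (e.1 - Pi.single ν 1) e.2 ν : Circle) : ℂ).im -
              ((plaquetteHolonomy V' (e.1 - Pi.single ν 1) e.2 ν : Circle) : ℂ).im) -
            (((plaquetteHolonomy V e.1 e.2 ν : Circle) : ℂ).im -
              ((plaquetteHolonomy V' e.1 e.2 ν : Circle) : ℂ).im) := by ring
        rw [hre]
        refine (abs_sub _ _).trans ?_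
        linarith
    _ = 8 * ((d - 1 : ℕ) : ℝ) * dist V V' := by
        rw [Finset.sum_const, nsmul_eq_mul, hcard]; ring

omit [NeZero L] in
/-- **The momentum increment `a · Z` is bounded link by link by `2(d−1)|a|`.** -/
theorem norm_smul_u1FlowField_apply_le (a : ℝ) (V : GaugeConfig d L Circle) (e : Edge d L) :
    ‖(fun (V : GaugeConfig d L Circle) (e : Edge d L) => a * ∑ ν ∈ Finset.univ.erase e.2,
        (((plaquetteHolonomy V (e.1 - Pi.single ν 1) e.2 ν : Circle) : ℂ).im -
          ((plaquetteHolonomy V e.1 e.2 ν : Circle) : ℂ).im)) V e‖ ≤ 2 * ((d - 1 : ℕ) : ℝ) * |a| := by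
  dsimp only
  rw [Real.norm_eq_abs, abs_mul]
  calc |a| * |∑ ν ∈ Finset.univ.erase e.2,
        (((plaquetteHolonomy V (e.1 - Pi.single ν 1) e.2 ν : Circle) : ℂ).im -
          ((plaquetteHolonomy V e.1 e.2 ν : Circle) : ℂ).im)|
      ≤ |a| * (2 * ((d - 1 : ℕ) : ℝ)) :=
        mul_le_mul_of_nonneg_left (abs_u1FlowField_le V e) (abs_nonneg a)
    _ = 2 * ((d - 1 : ℕ) : ℝ) * |a| := by ring

/-- **The momentum increment `a · Z` is `8(d−1)|a|`-Lipschitz** (chordal sup metric on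
configurations, sup norm on momenta). -/
theorem lipschitzWith_smul_u1FlowField (a : ℝ) :
    LipschitzWith (Real.toNNReal (8 * ((d - 1 : ℕ) : ℝ) * |a|))
      (fun (V : GaugeConfig d L Circle) (e : Edge d L) => a * ∑ ν ∈ Finset.univ.erase e.2,
        (((plaquetteHolonomy V (e.1 - Pi.single ν 1) e.2 ν : Circle) : ℂ).im -
          ((plaquetteHolonomy V e.1 e.2 ν : Circle) : ℂ).im)) := by
  refine LipschitzWith.of_dist_le_mul fun V V' => ?_
  rw [Real.coe_toNNReal _ (by positivity)]
  refine (dist_pi_le_iff (by positivity)).2 fun e => ?_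
  rw [Real.dist_eq, ← mul_sub, abs_mul]
  calc |a| * |(∑ ν ∈ Finset.univ.erase e.2,
        (((plaquetteHolonomy V (e.1 - Pi.single ν 1) e.2 ν : Circle) : ℂ).im -
          ((plaquetteHolonomy V e.1 e.2 ν : Circle) : ℂ).im)) -
      ∑ ν ∈ Finset.univ.erase e.2,
        (((plaquetteHolonomy V' (e.1 - Pi.single ν 1) e.2 ν : Circle) : ℂ).im -
          ((plaquetteHolonomy V' e.1 e.2 ν : Circle) : ℂ).im)|
      ≤ |a| * (8 * ((d - 1 : ℕ) : ℝ) * dist V V') :=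
        mul_le_mul_of_nonneg_left (abs_u1FlowField_sub_le V V' e) (abs_nonneg a)
    _ = 8 * ((d - 1 : ℕ) : ℝ) * |a| * dist V V' := by ring

/-- The momentum increment `a · Z` is measurable (it is Lipschitz, hence continuous). -/
theorem measurable_smul_u1FlowField (a : ℝ) :
    Measurable (fun (V : GaugeConfig d L Circle) (e : Edge d L) => a * ∑ ν ∈ Finset.univ.erase e.2,
        (((plaquetteHolonomy V (e.1 - Pi.single ν 1) e.2 ν : Circle) : ℂ).im -
          ((plaquetteHolonomy V e.1 e.2 ν : Circle) : ℂ).im)) :=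
  (lipschitzWith_smul_u1FlowField a).continuous.measurable

end Field

/-! ## §2 Row 9's multi-step Wilson HMC theorem with the hypothesis on the increment discharged -/

section Wilson

variable [NeZero L] {N : ℕ} (ρ : Circle →* Matrix (Fin N) (Fin N) ℂ)

/-- **MULTI-STEP LEAPFROG HMC WITH THE WILSON FORCE FIELD CONVERGES TO THE WILSON MEASURE FROM
EVERY START, FOR SHORT TRAJECTORIES — EXPLICITLY.**  Torus `(ℤ/L)^d`, continuous representation
`ρ` of `U(1)`, any `β`; momentum increment `a · Z` (ANY real `a`), `ε > 0`, `κ > 0`, `n ≥ 1`, and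
`32 (d−1) · |a| · ε · n² ≤ 3`: there is `δ ∈ (0, 1]` with `|μ₀K_nᵗ(A) − μ_{Λ,β}(A)| ≤ (1 − δ)ᵗ` for
every initial law `μ₀`, every `t`, every set `A`. -/
theorem wilson_u1LeapfrogHMCN_flowField_uniformlyErgodic (hρ : Continuous ρ) (β a : ℝ) {ε κ : ℝ}
    (hε : 0 < ε) (hκ : 0 < κ) {n : ℕ} (hn : 1 ≤ n)
    (hshort : 32 * ((d - 1 : ℕ) : ℝ) * |a| * ε * (n : ℝ) ^ 2 ≤ 3) :
    ∃ δ : ℝ, 0 < δ ∧ δ ≤ 1 ∧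
      ∀ (μ₀ : Measure (GaugeConfig d L Circle)) [IsProbabilityMeasure μ₀]
        (t : ℕ) (A : Set (GaugeConfig d L Circle)),
        |((fun m : Measure (GaugeConfig d L Circle) =>
              m.bind (u1LeapfrogHMCN ε κ (measurable_smul_u1FlowField (d := d) (L := L) a)
                (fun U => β * wilsonAction ρ U) n))^[t] μ₀).real A
            - (wilsonMeasure ρ β).real A| ≤ (1 - δ) ^ t := by
  have hK : 4 * ((Real.toNNReal (8 * ((d - 1 : ℕ) : ℝ) * |a|) : ℝ≥0) : ℝ) * ε * (n : ℝ) ^ 2 ≤ 3 := by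
    rw [Real.coe_toNNReal _ (by positivity)]
    linarith
  exact wilson_u1LeapfrogHMCN_uniformlyErgodic ρ hρ β hε hκ hn (measurable_smul_u1FlowField a)
    (lipschitzWith_smul_u1FlowField a) hK (by positivity : (0 : ℝ) ≤ 2 * ((d - 1 : ℕ) : ℝ) * |a|)
    (norm_smul_u1FlowField_apply_le a)

/-- **The Wilson measure is the unique invariant probability law** of that kernel (same
hypotheses). -/
theorem wilsonMeasure_unique_invariant_u1LeapfrogHMCN_flowField (hρ : Continuous ρ) (β a : ℝ)
    {ε κ : ℝ} (hε : 0 < ε) (hκ : 0 < κ) {n : ℕ} (hn : 1 ≤ n)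
    (hshort : 32 * ((d - 1 : ℕ) : ℝ) * |a| * ε * (n : ℝ) ^ 2 ≤ 3)
    {π' : Measure (GaugeConfig d L Circle)} [IsProbabilityMeasure π']
    (hπ' : Invariant (u1LeapfrogHMCN ε κ (measurable_smul_u1FlowField (d := d) (L := L) a)
      (fun U => β * wilsonAction ρ U) n) π') :
    π' = wilsonMeasure ρ β := by
  have hK : 4 * ((Real.toNNReal (8 * ((d - 1 : ℕ) : ℝ) * |a|) : ℝ≥0) : ℝ) * ε * (n : ℝ) ^ 2 ≤ 3 := by
    rw [Real.coe_toNNReal _ (by positivity)]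
    linarith
  exact wilsonMeasure_unique_invariant_u1LeapfrogHMCN ρ hρ β hε hκ hn (measurable_smul_u1FlowField a)
    (lipschitzWith_smul_u1FlowField a) hK (by positivity : (0 : ℝ) ≤ 2 * ((d - 1 : ℕ) : ℝ) * |a|)
    (norm_smul_u1FlowField_apply_le a) hπ'

end Wilson

end Summit.Ventures.LatticeQCDFlow.Exactness
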